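import Mathlib
import Literature.NumberTheory.LFunctions.Zhang2022.Section12Eq128Reduction
import HarnessLib

/-!
# Zhang (2022) §12 (12.8): the structure of the dual-side coefficient sequence `𝐜` of the
# window estimate `hS′` — bulk `O(e^{−c𝓛¹⁰})`, edges `O(𝓛⁻¹⁹)`, plus the sharp `g`-transition at `P″₂`

Topic `Literature/NumberTheory/LFunctions/Zhang2022` (Landau–Siegel audit tree; verdict-neutral).
Y. Zhang, *Discrete mean estimates and the Landau–Siegel zero*, arXiv:2211.02515v1 (2022)
[Zhang2022LandauSiegel], §12 p. 67 (tex L3424–L3447) — **an unrefereed manuscript under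
adjudication; nothing here asserts or denies its Theorems 1–2.** THEOREMS ONLY; 0 new definitions,
0 new facts (ZHANG-L lane, LIB-B floater under leaf hXi `Typed.Sec12A.Xi15Hbar16`; row G-d42-3).

`Typed.Sec12A.eq128_of_sj_small` (tree, `Section12Eq128Reduction`) reduces (12.8) to the estimate
`hS′`: `S_j(𝐜̄,𝐜) = o(α𝔞)` for the coefficient difference
`c(n) = χ(n)(n/P″₁)^{β₆}[I_D(n)/0.504·1_{P″₁η₋<n<P″₂η₊} − log(n/P″₁)/log P₁·1_{P″₁<n<P″₂}]`,
`I_D(n) = ∫_{0.496}^{0.5}{g(P^{0.5}Dt₀/n) − g(P^zDt₀/n)}dz` (`Typed.Sec12A.dualInt`). This file records what the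
manuscript's "above discussion" (the integral identity `IntGDual`, the tails) gives POINTWISE for
`𝐜` — the input of any proof of `hS′`, by evaluation or by majorants:

* `norm_cSeq_bulk_le` — **bulk**: for `P″₁η₊ < n < P″₂η₋`, `|c(n)| ≤ C·e^{−c𝓛¹⁰}` (`IntGDual`,
  `Typed.Sec12A.intGDual_holds`, and `log(n/P″₁)/log P₁ = (log n/log P − α̃ − 0.496)/0.504`);
* `abs_dualInt_le_low`, `abs_dualInt_sub_le_top` — the `z`-integral near the two edges:
  `|I_D(n)| ≤ 0.004e^{−𝓛¹⁰} + 2𝓛⁻¹⁹` for `n ≤ P″₁η₊`, and `|I_D(n) − 0.004·g(P″₂/n)| ≤ 0.002e^{−𝓛¹⁰} + 2𝓛⁻¹⁹`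
  for `n ≥ P″₂η₋` (split of `[0.496, 0.5]` at `2𝓛⁻¹⁹` from the endpoint, (4.2)/(4.3));
* `norm_cSeq_sub_sharp_le` — **globally** `|c(n) − s(n)| ≤ C·𝓛⁻¹⁹` where
  `s(n) = (0.004/0.504)χ(n)(n/P″₁)^{β₆}(g(P″₂/n) − 1_{n<P″₂})·1_{P″₂η₋≤n<P″₂η₊}` is the SHARP PART: the
  smooth step `g` of the dual sum against the sharp cut-off of `H̄₁₆` at `P″₂`;
* `norm_sharp_le` — `|s(n)| ≤ (0.002/0.504)·exp(−𝓛³⁰log²(P″₂/n))`: the sharp part lives on the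
  logarithmic scale `𝓛⁻¹⁵` around `P″₂` ((4.2)–(4.3), `GaussWeight.one_sub_gWeight_le`, `gWeight_le`).

So `𝐜 = 𝐬 + O(𝓛⁻¹⁹)` on `(P″₁η₋, P″₂η₊)` (and `= 0` outside), with `O(e^{−c𝓛¹⁰})` in the bulk:
the only `O(1)` coefficients of the window estimate are the `≈ P″₂𝓛⁻¹⁵` integers of the `g`-transition.

## References

* Y. Zhang, arXiv:2211.02515v1 (2022), §12 p. 67; §4 (4.1)–(4.3). [cite: Zhang2022LandauSiegel, §12 (12.8) p.67]
-/

noncomputable section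

open Complex Real ComplexConjugate

namespace Literature.NumberTheory.LFunctions.Zhang2022.Typed.Sec12A

open Skeleton

/-! ## §1. Sizes -/

/-- For `D ≥ ⌈e^M⌉`, `𝓛 = log D ≥ M`. [cite: Zhang2022LandauSiegel, §2 p.4] -/
private theorem le_ell_of_ceil_exp_le' {M : ℝ} {D : ℕ} (hD : ⌈Real.exp M⌉₊ ≤ D) : M ≤ ell D := by
  have h : Real.exp M ≤ D := le_trans (Nat.le_ceil _) (by exact_mod_cast hD)
  exact (Real.le_log_iff_exp_le (lt_of_lt_of_le (Real.exp_pos _) h)).mpr h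

/-- `e^{−y} ≤ 2/y²` for `y > 0`. [folklore] -/
private theorem exp_neg_le_two_div_sq {y : ℝ} (hy : 0 < y) : Real.exp (-y) ≤ 2 / y ^ 2 := by
  have h1 : 1 + y + y ^ 2 / 2 ≤ Real.exp y := Real.quadratic_le_exp_of_nonneg hy.le
  have h2 : y ^ 2 / 2 ≤ Real.exp y := by linarith
  rw [Real.exp_neg, inv_eq_one_div, div_le_div_iff₀ (Real.exp_pos y) (by positivity)]
  nlinarith

/-- `e^{−𝓛¹⁰} ≤ 𝓛⁻¹⁹` for `𝓛 ≥ 2`. [cite: Zhang2022LandauSiegel, §4 p.18] -/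
theorem exp_neg_ell_ten_le {D : ℕ} (hℓ2 : 2 ≤ ell D) : Real.exp (-(ell D ^ 10)) ≤ (ell D ^ 19)⁻¹ := by
  have hℓ : 0 < ell D := by linarith
  refine le_trans (exp_neg_le_two_div_sq (pow_pos hℓ 10)) ?_
  rw [div_le_iff₀ (by positivity), ← one_div, one_div_mul_eq_div, le_div_iff₀ (by positivity)]
  have : (2 : ℝ) * ell D ^ 19 ≤ (ell D ^ 10) ^ 2 := by
    rw [← pow_mul]
    calc (2 : ℝ) * ell D ^ 19 ≤ ell D * ell D ^ 19 := by gcongr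
      _ = ell D ^ (10 * 2) := by ring
  linarith

section Coefficients

variable {D : ℕ} (χ : DirichletCharacter ℂ D)

/-- `log(y/P″₁) = 𝓛⁹·(log y/log P − α̃ − 0.496)` (`P″₁ = P^{0.496}Dt₀`, `log P = 𝓛⁹`,
`α̃ = log(Dt₀)/log P`). [cite: Zhang2022LandauSiegel, §12 p.67; §2 (2.30)] -/
theorem log_div_P1pp_eq (hD : 1 ≤ Real.log D) {y : ℝ} (hy : 0 < y) :
    Real.log (y / P1pp D) = ell D ^ 9 * (Real.log y / Real.log (bigP D) - alphaTilde D - 0.496) := by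
  have hD0 := Sec12D.natCast_pos_of_one_le_log hD
  have hℓ : 0 < ell D := by rw [ell]; linarith
  have ht0 : 0 < t0 D := pow_pos hℓ 519
  have hP : 0 < bigP D := bigP_pos D
  have hlogP : Real.log (bigP D) = ell D ^ 9 := log_bigP D
  have hP1pp : P1pp D = bigP D ^ (0.496 : ℝ) * ((D : ℝ) * t0 D) := by rw [P1pp]; ring
  rw [Real.log_div hy.ne' (Sec12D.P1pp_pos hD).ne', hP1pp,
    Real.log_mul (Real.rpow_pos_of_pos hP _).ne' (mul_pos hD0 ht0).ne', Real.log_rpow hP,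
    alphaTilde, hlogP]
  field_simp
  ring

/-- Membership in the main range `P″₁η₋ < n < P″₂η₊` (the index set of `c₀`).
[cite: Zhang2022LandauSiegel, §12 p.67] -/
theorem mem_mainRange {n : ℕ} (hn : 1 ≤ n) (h1 : P1pp D * etaPM D (-1) < n)
    (h2 : (n : ℝ) < P2pp D * etaPM D 1) :
    n ∈ ((Finset.Ico 1 ⌈P2pp D * etaPM D 1⌉₊).filter
          (fun n : ℕ => P1pp D * etaPM D (-1) < n ∧ (n : ℝ) < P2pp D * etaPM D 1)) :=
  Finset.mem_filter.mpr ⟨Finset.mem_Ico.mpr ⟨hn, Nat.lt_ceil.mpr h2⟩, h1, h2⟩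

/-- Membership in the range `P″₁ < n < P″₂` of `H̄₁₆` (the index set of `c₁`).
[cite: Zhang2022LandauSiegel, §12 p.67] -/
theorem mem_S16_iff {n : ℕ} (hn : 1 ≤ n) :
    n ∈ ((Finset.Ico 1 ⌈P2pp D⌉₊).filter (fun n : ℕ => P1pp D < n ∧ (n : ℝ) < P2pp D)) ↔
      P1pp D < n ∧ (n : ℝ) < P2pp D := by
  constructor
  · intro h; exact (Finset.mem_filter.mp h).2
  · intro h
    exact Finset.mem_filter.mpr ⟨Finset.mem_Ico.mpr ⟨hn, Nat.lt_ceil.mpr h.2⟩, h.1, h.2⟩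

/-- Basic sizes at `𝓛 ≥ 2`: `η₊ = e^{𝓛⁻¹⁰}`, `η₋ = e^{−𝓛⁻¹⁰}`, `η₊ < P^{0.004}η₋²` (so the edge windows
are disjoint and inside `(P″₁, P″₂)`-order), `P″₂ = P^{0.004}P″₁`. [cite: Zhang2022LandauSiegel, §12 p.67] -/
theorem edge_sizes (hℓ2 : 2 ≤ ell D) :
    0 < etaPM D 1 ∧ 0 < etaPM D (-1) ∧ etaPM D (-1) < 1 ∧ 1 < etaPM D 1 ∧
      etaPM D 1 * etaPM D 1 < bigP D ^ (0.004 : ℝ) * etaPM D (-1) := by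
  have hℓ : 0 < ell D := by linarith
  have hm : 0 < (ell D ^ 10)⁻¹ := inv_pos.mpr (pow_pos hℓ 10)
  have hm1 : (ell D ^ 10)⁻¹ ≤ 1 := inv_le_one_of_one_le₀ (one_le_pow₀ (by linarith))
  refine ⟨Real.exp_pos _, Real.exp_pos _, ?_, ?_, ?_⟩
  · rw [etaPM]; exact Real.exp_lt_one_iff.mpr (by linarith)
  · rw [etaPM]; exact Real.one_lt_exp_iff.mpr (by linarith)
  · rw [etaPM, etaPM, bigP, ← Real.exp_mul, ← Real.exp_add, ← Real.exp_add, Real.exp_lt_exp]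
    have h9 : (512 : ℝ) ≤ ell D ^ 9 := by
      have h := pow_le_pow_left₀ (by norm_num : (0 : ℝ) ≤ 2) hℓ2 9
      norm_num at h; exact h
    have hm_small : (ell D ^ 10)⁻¹ ≤ 1 / 1024 := by
      have h10 : (1024 : ℝ) ≤ ell D ^ 10 := by
        have h := pow_le_pow_left₀ (by norm_num : (0 : ℝ) ≤ 2) hℓ2 10
        norm_num at h; exact h
      rw [one_div]; exact inv_anti₀ (by norm_num) h10
    nlinarith

/-! ## §2. The bulk: `IntGDual` makes `c` exponentially small -/

/-- **Bulk smallness of `𝐜`**: for `P″₁η₊ < n < P″₂η₋`, `|c(n)| ≤ C·e^{−c𝓛¹⁰}` — by `IntGDual`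
(`intGDual_holds`): there `I_D(n) = log n/log P − α̃ − 0.496 + O(e^{−c𝓛¹⁰})`, which is exactly
`0.504·log(n/P″₁)/log P₁`. [cite: Zhang2022LandauSiegel, §12 p.67, tex L3434–L3439] -/
theorem norm_cSeq_bulk_le : ∃ c : ℝ, 0 < c ∧ ∃ C : ℝ, ForAllLarge fun D _ χ => ∀ n : ℕ,
    P1pp D * etaPM D 1 < n → (n : ℝ) < P2pp D * etaPM D (-1) →
      ‖(fun n : ℕ => ((if n ∈ ((Finset.Ico 1 ⌈P2pp D * etaPM D 1⌉₊).filter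
          (fun n : ℕ => P1pp D * etaPM D (-1) < n ∧ (n : ℝ) < P2pp D * etaPM D 1)) then
          χ (n : ZMod D) * (((n : ℝ) / P1pp D : ℝ) : ℂ) ^ beta6 D * ((dualInt D n / 0.504 : ℝ) : ℂ)
        else 0) -
        (if n ∈ ((Finset.Ico 1 ⌈P2pp D⌉₊).filter (fun n : ℕ => P1pp D < n ∧ (n : ℝ) < P2pp D)) then
          χ (n : ZMod D) * (((n : ℝ) / P1pp D : ℝ) : ℂ) ^ beta6 D *
            ((Real.log ((n : ℝ) / P1pp D) / Real.log (Skeleton.P1 D) : ℝ) : ℂ)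
        else 0))) n‖ ≤ C * Real.exp (-c * ell D ^ 10) := by
  obtain ⟨c, hc, C, D₀, h⟩ := intGDual_holds
  refine ⟨c, hc, |C| / 0.504, max D₀ ⌈Real.exp 2⌉₊, fun D _ χ hD hq hp n h1 h2 => ?_⟩
  have hD₀ : D₀ ≤ D := le_trans (le_max_left _ _) hD
  have hℓ2 : 2 ≤ ell D := le_ell_of_ceil_exp_le' (le_trans (le_max_right _ _) hD)
  have hℓ : 0 < ell D := by linarith
  have hD1 : 1 ≤ Real.log D := by rw [← ell]; linarith
  obtain ⟨hη1, hη2, hη3, hη4, -⟩ := edge_sizes hℓ2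
  have hP1pp := Sec12D.P1pp_pos hD1
  have hP2pp := Sec12D.P2pp_pos hD1
  have hn0 : (0 : ℝ) < n := lt_trans (mul_pos hP1pp hη1) h1
  have hn : 1 ≤ n := by exact_mod_cast hn0
  -- the two memberships
  have hlow : P1pp D * etaPM D (-1) < n := lt_trans (by nlinarith) h1
  have hupp : (n : ℝ) < P2pp D * etaPM D 1 := lt_trans h2 (by nlinarith)
  have hm : n ∈ ((Finset.Ico 1 ⌈P2pp D * etaPM D 1⌉₊).filter
          (fun n : ℕ => P1pp D * etaPM D (-1) < n ∧ (n : ℝ) < P2pp D * etaPM D 1)) := mem_mainRange hn hlow hupp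
  have h16 : n ∈ ((Finset.Ico 1 ⌈P2pp D⌉₊).filter (fun n : ℕ => P1pp D < n ∧ (n : ℝ) < P2pp D)) :=
    (mem_S16_iff hn).mpr ⟨lt_trans (by nlinarith) h1, lt_trans h2 (by nlinarith)⟩
  have key := h D χ hD₀ hq hp n h1 h2
  simp only [hm, h16, if_true]
  have hr : 0 < (n : ℝ) / P1pp D := div_pos hn0 hP1pp
  -- `log(n/P″₁)/log P₁ = (log n/log P − α̃ − 0.496)/0.504`
  have hlog : Real.log ((n : ℝ) / P1pp D) / Real.log (Skeleton.P1 D) =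
      (Real.log n / Real.log (bigP D) - alphaTilde D - 0.496) / 0.504 := by
    rw [log_div_P1pp_eq hD1 hn0, Sec12D.log_P1_eq_mul, log_bigP]
    field_simp
  rw [← mul_sub, norm_mul, norm_mul, norm_cpow_beta6 hr, mul_one, ← Complex.ofReal_sub,
    Complex.norm_real, Real.norm_eq_abs, hlog, dualInt,
    show ∀ a b : ℝ, a / 0.504 - b / 0.504 = (a - b) / 0.504 from fun a b => by ring, abs_div,
    abs_of_pos (by norm_num : (0 : ℝ) < 0.504)]
  have hχ := DirichletCharacter.norm_le_one χ (n : ZMod D)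
  calc ‖χ (n : ZMod D)‖ * (|(∫ z in (0.496 : ℝ)..0.5,
          (gW D (bigP D ^ (0.5 : ℝ) * D * t0 D / n) - gW D (bigP D ^ z * D * t0 D / n))) -
          (Real.log n / Real.log (bigP D) - alphaTilde D - 0.496)| / 0.504)
      ≤ 1 * (C * Real.exp (-c * ell D ^ 10) / 0.504) := by gcongr
    _ ≤ |C| / 0.504 * Real.exp (-c * ell D ^ 10) := by
        rw [one_mul, div_eq_mul_one_div, div_eq_mul_one_div |C|]
        nlinarith [le_abs_self C, Real.exp_pos (-c * ell D ^ 10)]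

/-! ## §3. The `z`-integral near the two edges -/

/-- **Near `P″₁`** (`1 ≤ n ≤ P″₁η₊`, `𝓛 ≥ 2`): `|I_D(n)| ≤ 0.004e^{−𝓛¹⁰} + 2𝓛⁻¹⁹` — on
`[0.496 + 2𝓛⁻¹⁹, 0.5]` both `g`'s are within `½e^{−𝓛¹⁰}` of `1` ((4.2)), on the initial piece the
integrand is `≤ 1`. [cite: Zhang2022LandauSiegel, §12 p.67; §4 (4.2)] -/
theorem abs_dualInt_le_low (hℓ2 : 2 ≤ ell D) {n : ℕ} (hn : 1 ≤ n) (hn1 : (n : ℝ) ≤ P1pp D * etaPM D 1) :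
    |dualInt D n| ≤ 0.004 * Real.exp (-(ell D ^ 10)) + 2 * (ell D ^ 19)⁻¹ := by
  have hℓ : 0 < ell D := by linarith
  have hD1 : 1 ≤ Real.log D := by rw [← ell]; linarith
  have hD0 := Sec12D.natCast_pos_of_one_le_log hD1
  have ht0 : 0 < t0 D := pow_pos hℓ 519
  have hL0 : 0 < ell D ^ 9 := pow_pos hℓ 9
  have hP0 : 0 < bigP D := bigP_pos D
  have hP1le : 1 ≤ bigP D := one_le_bigP' D
  have hP1pp := Sec12D.P1pp_pos hD1
  have hn0 : (0 : ℝ) < n := by exact_mod_cast hn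
  have h19 : (ell D ^ 19)⁻¹ = (ell D ^ 10)⁻¹ / ell D ^ 9 := by
    rw [div_eq_mul_inv, ← mul_inv, ← pow_add]
  set δ : ℝ := 2 * (ell D ^ 10)⁻¹ / ell D ^ 9 with hδ
  have hδ0 : 0 ≤ δ := by positivity
  have hδ1 : δ ≤ 0.004 := by
    have hm_small : (ell D ^ 10)⁻¹ ≤ 1 / 1024 := by
      have h10 : (1024 : ℝ) ≤ ell D ^ 10 := by
        have h := pow_le_pow_left₀ (by norm_num : (0 : ℝ) ≤ 2) hℓ2 10
        norm_num at h; exact h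
      rw [one_div]; exact inv_anti₀ (by norm_num) h10
    have h1 : δ ≤ 2 * (ell D ^ 10)⁻¹ := div_le_self (by positivity) (by
      have h := pow_le_pow_left₀ (by norm_num : (0 : ℝ) ≤ 2) hℓ2 9
      norm_num at h; linarith)
    linarith
  set zs : ℝ := 0.496 + δ with hzs
  have hzs1 : 0.496 ≤ zs := by rw [hzs]; linarith
  have hzs2 : zs ≤ 0.5 := by rw [hzs]; linarith
  set F : ℝ → ℝ := fun z =>
    gW D (bigP D ^ (0.5 : ℝ) * D * t0 D / n) - gW D (bigP D ^ z * D * t0 D / n) with hF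
  have hanti : Antitone F := by
    intro z₁ z₂ hz
    have h1 : bigP D ^ z₁ * D * t0 D / n ≤ bigP D ^ z₂ * D * t0 D / n :=
      div_le_div_of_nonneg_right (mul_le_mul_of_nonneg_right (mul_le_mul_of_nonneg_right
        (Real.rpow_le_rpow_of_exponent_le hP1le hz) hD0.le) ht0.le) hn0.le
    have h2 : gW D (bigP D ^ z₁ * D * t0 D / n) ≤ gW D (bigP D ^ z₂ * D * t0 D / n) :=
      GaussWeight.gWeight_mono (pow_pos hℓ 30) (by positivity) h1
    simp only [hF]
    linarith
  have hint : ∀ a b : ℝ, IntervalIntegrable F MeasureTheory.volume a b :=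
    fun a b => hanti.intervalIntegrable
  have hsplit : ∫ z in (0.496 : ℝ)..0.5, F z = (∫ z in (0.496 : ℝ)..zs, F z) + ∫ z in zs..0.5, F z :=
    (intervalIntegral.integral_add_adjacent_intervals (hint _ _) (hint _ _)).symm
  -- on `[zs, 0.5]`: both arguments of `g` are `≥ e^{𝓛⁻¹⁰}`
  have hn1' : (n : ℝ) ≤ Real.exp (ell D ^ 9 * 0.496 + (ell D ^ 10)⁻¹) * ((D : ℝ) * t0 D) := by
    have e : P1pp D * etaPM D 1 = Real.exp (ell D ^ 9 * 0.496 + (ell D ^ 10)⁻¹) * ((D : ℝ) * t0 D) := by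
      rw [P1pp, bigP, ← Real.exp_mul, etaPM, one_mul, Real.exp_add]; ring
    rw [← e]; exact hn1
  have key : ∀ w : ℝ, zs ≤ w → Real.exp ((ell D ^ 10)⁻¹) ≤ bigP D ^ w * D * t0 D / n := by
    intro w hw
    rw [le_div_iff₀ hn0]
    calc Real.exp ((ell D ^ 10)⁻¹) * n
        ≤ Real.exp ((ell D ^ 10)⁻¹) * (Real.exp (ell D ^ 9 * 0.496 + (ell D ^ 10)⁻¹) * ((D : ℝ) * t0 D)) :=
          mul_le_mul_of_nonneg_left hn1' (Real.exp_pos _).le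
      _ = Real.exp (ell D ^ 9 * zs) * ((D : ℝ) * t0 D) := by
          have e : Real.exp ((ell D ^ 10)⁻¹) * Real.exp (ell D ^ 9 * 0.496 + (ell D ^ 10)⁻¹) =
              Real.exp (ell D ^ 9 * zs) := by
            rw [← Real.exp_add]; congr 1; rw [hzs, hδ]; field_simp; ring
          rw [← e]; ring
      _ ≤ Real.exp (ell D ^ 9 * w) * ((D : ℝ) * t0 D) := by gcongr
      _ = bigP D ^ w * D * t0 D := by rw [bigP, ← Real.exp_mul]; ring
  have hA : ∀ z ∈ Set.uIoc zs (0.5 : ℝ), ‖F z‖ ≤ Real.exp (-(ell D ^ 10)) := by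
    intro z hz
    rw [Set.uIoc_of_le hzs2, Set.mem_Ioc] at hz
    have h1 := abs_one_sub_gW_le hℓ (key z hz.1.le)
    have h2 := abs_one_sub_gW_le hℓ (key 0.5 hzs2)
    simp only [hF]
    rw [Real.norm_eq_abs]
    have := abs_sub_le (1 - gW D (bigP D ^ z * D * t0 D / n)) 0 (1 - gW D (bigP D ^ (0.5 : ℝ) * D * t0 D / n))
    rw [show gW D (bigP D ^ (0.5 : ℝ) * D * t0 D / n) - gW D (bigP D ^ z * D * t0 D / n) =
      (1 - gW D (bigP D ^ z * D * t0 D / n)) - (1 - gW D (bigP D ^ (0.5 : ℝ) * D * t0 D / n)) by ring]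
    calc |(1 - gW D (bigP D ^ z * D * t0 D / n)) - (1 - gW D (bigP D ^ (0.5 : ℝ) * D * t0 D / n))|
        ≤ |1 - gW D (bigP D ^ z * D * t0 D / n)| + |1 - gW D (bigP D ^ (0.5 : ℝ) * D * t0 D / n)| :=
          abs_sub _ _
      _ ≤ 1 / 2 * Real.exp (-(ell D ^ 10)) + 1 / 2 * Real.exp (-(ell D ^ 10)) := add_le_add h1 h2
      _ = Real.exp (-(ell D ^ 10)) := by ring
  have hB : ∀ z ∈ Set.uIoc (0.496 : ℝ) zs, ‖F z‖ ≤ 1 := by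
    intro z _
    simp only [hF]
    rw [Real.norm_eq_abs]
    exact abs_gW_sub_gW_le_one hℓ _ _
  have hIA := intervalIntegral.norm_integral_le_of_norm_le_const hA
  have hIB := intervalIntegral.norm_integral_le_of_norm_le_const hB
  rw [Real.norm_eq_abs] at hIA hIB
  have e1 : |0.5 - zs| ≤ 0.004 := by rw [abs_of_nonneg (by linarith), hzs]; linarith
  have e2 : |zs - 0.496| = δ := by rw [abs_of_nonneg (by linarith), hzs]; ring
  have hE : 0 ≤ Real.exp (-(ell D ^ 10)) := (Real.exp_pos _).le
  rw [dualInt, show (fun z => gW D (bigP D ^ (0.5 : ℝ) * ↑D * t0 D / ↑n) - gW D (bigP D ^ z * ↑D * t0 D / ↑n)) = F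
    from rfl, hsplit]
  calc |(∫ z in (0.496 : ℝ)..zs, F z) + ∫ z in zs..0.5, F z|
      ≤ |∫ z in (0.496 : ℝ)..zs, F z| + |∫ z in zs..0.5, F z| := abs_add_le _ _
    _ ≤ 1 * |zs - 0.496| + Real.exp (-(ell D ^ 10)) * |0.5 - zs| := add_le_add hIB hIA
    _ ≤ 1 * δ + Real.exp (-(ell D ^ 10)) * 0.004 := by
        rw [e2]; exact add_le_add le_rfl (mul_le_mul_of_nonneg_left e1 hE)
    _ = 0.004 * Real.exp (-(ell D ^ 10)) + 2 * (ell D ^ 19)⁻¹ := by rw [hδ, h19]; ring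

/-- **Near `P″₂`** (`n ≥ P″₂η₋`, `𝓛 ≥ 2`): `|I_D(n) − 0.004·g(P″₂/n)| ≤ 0.002e^{−𝓛¹⁰} + 2𝓛⁻¹⁹` — the
first `g` integrates to `0.004·g(P″₂/n)` exactly; the second is `≤ ½e^{−𝓛¹⁰}` on `[0.496, 0.5 − 2𝓛⁻¹⁹]`
((4.3)) and `≤ 1` on the final piece. [cite: Zhang2022LandauSiegel, §12 p.67; §4 (4.3)] -/
theorem abs_dualInt_sub_le_top (hℓ2 : 2 ≤ ell D) {n : ℕ} (hn1 : P2pp D * etaPM D (-1) ≤ n) :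
    |dualInt D n - 0.004 * gW D (P2pp D / n)| ≤
      0.002 * Real.exp (-(ell D ^ 10)) + 2 * (ell D ^ 19)⁻¹ := by
  have hℓ : 0 < ell D := by linarith
  have hD1 : 1 ≤ Real.log D := by rw [← ell]; linarith
  have hD0 := Sec12D.natCast_pos_of_one_le_log hD1
  have ht0 : 0 < t0 D := pow_pos hℓ 519
  have hL0 : 0 < ell D ^ 9 := pow_pos hℓ 9
  have hP0 : 0 < bigP D := bigP_pos D
  have hP1le : 1 ≤ bigP D := one_le_bigP' D
  have hP2pp := Sec12D.P2pp_pos hD1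
  have hn0 : (0 : ℝ) < n := lt_of_lt_of_le (mul_pos hP2pp (Real.exp_pos _)) hn1
  have h19 : (ell D ^ 19)⁻¹ = (ell D ^ 10)⁻¹ / ell D ^ 9 := by
    rw [div_eq_mul_inv, ← mul_inv, ← pow_add]
  set δ : ℝ := 2 * (ell D ^ 10)⁻¹ / ell D ^ 9 with hδ
  have hδ0 : 0 ≤ δ := by positivity
  have hδ1 : δ ≤ 0.004 := by
    have hm_small : (ell D ^ 10)⁻¹ ≤ 1 / 1024 := by
      have h10 : (1024 : ℝ) ≤ ell D ^ 10 := by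
        have h := pow_le_pow_left₀ (by norm_num : (0 : ℝ) ≤ 2) hℓ2 10
        norm_num at h; exact h
      rw [one_div]; exact inv_anti₀ (by norm_num) h10
    have h1 : δ ≤ 2 * (ell D ^ 10)⁻¹ := div_le_self (by positivity) (by
      have h := pow_le_pow_left₀ (by norm_num : (0 : ℝ) ≤ 2) hℓ2 9
      norm_num at h; linarith)
    linarith
  set zs : ℝ := 0.5 - δ with hzs
  have hzs1 : 0.496 ≤ zs := by rw [hzs]; linarith
  have hzs2 : zs ≤ 0.5 := by rw [hzs]; linarith
  -- the integral of the first `g` is exact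
  have hI : dualInt D n - 0.004 * gW D (P2pp D / n) =
      -∫ z in (0.496 : ℝ)..0.5, gW D (bigP D ^ z * D * t0 D / n) := by
    have hG : IntervalIntegrable (fun z : ℝ => gW D (bigP D ^ z * D * t0 D / n))
        MeasureTheory.volume 0.496 0.5 := by
      refine Monotone.intervalIntegrable fun z₁ z₂ hz => ?_
      have h1 : bigP D ^ z₁ * D * t0 D / n ≤ bigP D ^ z₂ * D * t0 D / n :=
        div_le_div_of_nonneg_right (mul_le_mul_of_nonneg_right (mul_le_mul_of_nonneg_right
          (Real.rpow_le_rpow_of_exponent_le hP1le hz) hD0.le) ht0.le) hn0.le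
      exact GaussWeight.gWeight_mono (pow_pos hℓ 30) (by positivity) h1
    rw [dualInt, intervalIntegral.integral_sub intervalIntegrable_const hG,
      intervalIntegral.integral_const, smul_eq_mul, P2pp]
    norm_num
  rw [hI, abs_neg]
  set G : ℝ → ℝ := fun z => gW D (bigP D ^ z * D * t0 D / n) with hG
  have hmono : Monotone G := by
    intro z₁ z₂ hz
    have h1 : bigP D ^ z₁ * D * t0 D / n ≤ bigP D ^ z₂ * D * t0 D / n :=
      div_le_div_of_nonneg_right (mul_le_mul_of_nonneg_right (mul_le_mul_of_nonneg_right
        (Real.rpow_le_rpow_of_exponent_le hP1le hz) hD0.le) ht0.le) hn0.le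
    exact GaussWeight.gWeight_mono (pow_pos hℓ 30) (by positivity) h1
  have hint : ∀ a b : ℝ, IntervalIntegrable G MeasureTheory.volume a b :=
    fun a b => hmono.intervalIntegrable
  have hsplit : ∫ z in (0.496 : ℝ)..0.5, G z = (∫ z in (0.496 : ℝ)..zs, G z) + ∫ z in zs..0.5, G z :=
    (intervalIntegral.integral_add_adjacent_intervals (hint _ _) (hint _ _)).symm
  -- on `[0.496, zs]`: the argument of `g` is `≤ e^{−𝓛⁻¹⁰}`
  have hn1' : Real.exp (ell D ^ 9 * 0.5 + -(ell D ^ 10)⁻¹) * ((D : ℝ) * t0 D) ≤ n := by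
    have e : P2pp D * etaPM D (-1) = Real.exp (ell D ^ 9 * 0.5 + -(ell D ^ 10)⁻¹) * ((D : ℝ) * t0 D) := by
      rw [P2pp, bigP, ← Real.exp_mul, etaPM, neg_one_mul, Real.exp_add]; ring
    rw [← e]; exact hn1
  have key : ∀ w : ℝ, w ≤ zs → bigP D ^ w * D * t0 D / n ≤ Real.exp (-(ell D ^ 10)⁻¹) := by
    intro w hw
    rw [div_le_iff₀ hn0]
    calc bigP D ^ w * D * t0 D = Real.exp (ell D ^ 9 * w) * ((D : ℝ) * t0 D) := by
          rw [bigP, ← Real.exp_mul]; ring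
      _ ≤ Real.exp (ell D ^ 9 * zs) * ((D : ℝ) * t0 D) := by gcongr
      _ = Real.exp (-(ell D ^ 10)⁻¹) * (Real.exp (ell D ^ 9 * 0.5 + -(ell D ^ 10)⁻¹) * ((D : ℝ) * t0 D)) := by
          have e : Real.exp (-(ell D ^ 10)⁻¹) * Real.exp (ell D ^ 9 * 0.5 + -(ell D ^ 10)⁻¹) =
              Real.exp (ell D ^ 9 * zs) := by
            rw [← Real.exp_add]; congr 1; rw [hzs, hδ]; field_simp; ring
          rw [← e]; ring
      _ ≤ Real.exp (-(ell D ^ 10)⁻¹) * n := mul_le_mul_of_nonneg_left hn1' (Real.exp_pos _).le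
  have hA : ∀ z ∈ Set.uIoc (0.496 : ℝ) zs, ‖G z‖ ≤ 1 / 2 * Real.exp (-(ell D ^ 10)) := by
    intro z hz
    rw [Set.uIoc_of_le hzs1, Set.mem_Ioc] at hz
    have h1 : G z ≤ 1 / 2 * Real.exp (-(ell D ^ 10)) :=
      gW_le_of_le_exp_neg hℓ (by positivity) (key z hz.2)
    have g1 : 0 < G z := GaussWeight.gWeight_pos (pow_pos hℓ 30) _
    rw [Real.norm_eq_abs, abs_of_pos g1]; exact h1
  have hB : ∀ z ∈ Set.uIoc zs (0.5 : ℝ), ‖G z‖ ≤ 1 := by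
    intro z _
    have g1 : 0 < G z := GaussWeight.gWeight_pos (pow_pos hℓ 30) _
    have g2 : G z < 1 := GaussWeight.gWeight_lt_one (pow_pos hℓ 30) _
    rw [Real.norm_eq_abs, abs_of_pos g1]; exact g2.le
  have hIA := intervalIntegral.norm_integral_le_of_norm_le_const hA
  have hIB := intervalIntegral.norm_integral_le_of_norm_le_const hB
  rw [Real.norm_eq_abs] at hIA hIB
  have e1 : |zs - 0.496| ≤ 0.004 := by rw [abs_of_nonneg (by linarith), hzs]; linarith
  have e2 : |0.5 - zs| = δ := by rw [abs_of_nonneg (by linarith), hzs]; ring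
  have hE : 0 ≤ 1 / 2 * Real.exp (-(ell D ^ 10)) := by positivity
  rw [hsplit]
  calc |(∫ z in (0.496 : ℝ)..zs, G z) + ∫ z in zs..0.5, G z|
      ≤ |∫ z in (0.496 : ℝ)..zs, G z| + |∫ z in zs..0.5, G z| := abs_add_le _ _
    _ ≤ 1 / 2 * Real.exp (-(ell D ^ 10)) * |zs - 0.496| + 1 * |0.5 - zs| := add_le_add hIA hIB
    _ ≤ 1 / 2 * Real.exp (-(ell D ^ 10)) * 0.004 + 1 * δ := by
        rw [e2]; exact add_le_add (mul_le_mul_of_nonneg_left e1 hE) le_rfl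
    _ = 0.002 * Real.exp (-(ell D ^ 10)) + 2 * (ell D ^ 19)⁻¹ := by rw [hδ, h19]; ring

/-! ## §4. `c = s + O(𝓛⁻¹⁹)` everywhere, `s` the sharp `g`-transition at `P″₂` -/

set_option maxHeartbeats 400000 in
/-- **`𝐜` is its sharp part plus `O(𝓛⁻¹⁹)`**: for all large `D` and every `n`,
`|c(n) − s(n)| ≤ C𝓛⁻¹⁹`, `s(n) = (0.004/0.504)χ(n)(n/P″₁)^{β₆}(g(P″₂/n) − 1_{n<P″₂})·1_{P″₂η₋≤n<P″₂η₊}`: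
outside `(P″₁η₋, P″₂η₊)` both vanish; in the bulk `c` is exponentially small (`norm_cSeq_bulk_le`);
on the `P″₁`-edge `|I_D| ≤ 0.004e^{−𝓛¹⁰} + 2𝓛⁻¹⁹` and `0 ≤ log(n/P″₁)/log P₁ ≤ 𝓛⁻¹⁹/0.504`; on the
`P″₂`-edge `I_D = 0.004g(P″₂/n) + O(…)` and `log(n/P″₁)/log P₁ = 0.004/0.504 + O(𝓛⁻¹⁹)` below `P″₂`.
[cite: Zhang2022LandauSiegel, §12 p.67] -/
theorem norm_cSeq_sub_sharp_le : ∃ C : ℝ, ForAllLarge fun D _ χ => ∀ n : ℕ,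
    ‖(fun n : ℕ => ((if n ∈ ((Finset.Ico 1 ⌈P2pp D * etaPM D 1⌉₊).filter
          (fun n : ℕ => P1pp D * etaPM D (-1) < n ∧ (n : ℝ) < P2pp D * etaPM D 1)) then
          χ (n : ZMod D) * (((n : ℝ) / P1pp D : ℝ) : ℂ) ^ beta6 D * ((dualInt D n / 0.504 : ℝ) : ℂ)
        else 0) -
        (if n ∈ ((Finset.Ico 1 ⌈P2pp D⌉₊).filter (fun n : ℕ => P1pp D < n ∧ (n : ℝ) < P2pp D)) then
          χ (n : ZMod D) * (((n : ℝ) / P1pp D : ℝ) : ℂ) ^ beta6 D *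
            ((Real.log ((n : ℝ) / P1pp D) / Real.log (Skeleton.P1 D) : ℝ) : ℂ)
        else 0))) n -
      (if P2pp D * etaPM D (-1) ≤ n ∧ (n : ℝ) < P2pp D * etaPM D 1 then
          ((0.004 / 0.504 : ℝ) : ℂ) * χ (n : ZMod D) * (((n : ℝ) / P1pp D : ℝ) : ℂ) ^ beta6 D *
            ((gW D (P2pp D / n) - (if (n : ℝ) < P2pp D then 1 else 0) : ℝ) : ℂ)
        else 0)‖ ≤ C * (ell D ^ 19)⁻¹ := by
  obtain ⟨c, hc, C, D₀, hbulk⟩ := norm_cSeq_bulk_le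
  refine ⟨max 7 (|C| * (2 / c ^ 2)), max D₀ ⌈Real.exp 2⌉₊, fun D _ χ hD hq hp n => ?_⟩
  have hD₀ : D₀ ≤ D := le_trans (le_max_left _ _) hD
  have hℓ2 : 2 ≤ ell D := le_ell_of_ceil_exp_le' (le_trans (le_max_right _ _) hD)
  have hℓ : 0 < ell D := by linarith
  have hℓ1 : 1 ≤ ell D := by linarith
  have hD1 : 1 ≤ Real.log D := by rw [← ell]; linarith
  have hL0 : 0 < ell D ^ 9 := pow_pos hℓ 9
  have h19pos : 0 < (ell D ^ 19)⁻¹ := inv_pos.mpr (pow_pos hℓ 19)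
  obtain ⟨hη1, hη2, hη3, hη4, hη5⟩ := edge_sizes hℓ2
  have hP1pp := Sec12D.P1pp_pos hD1
  have hP2pp := Sec12D.P2pp_pos hD1
  have hPP : P2pp D = bigP D ^ (0.004 : ℝ) * P1pp D := by
    have := Sec12D.P2pp_div_P1pp hD1
    rw [div_eq_iff hP1pp.ne'] at this; exact this
  have hexp := exp_neg_ell_ten_le hℓ2
  have hlogP1 : Real.log (Skeleton.P1 D) = 0.504 * ell D ^ 9 := by
    rw [Sec12D.log_P1_eq_mul, log_bigP]
  have hmax7 : (7 : ℝ) * (ell D ^ 19)⁻¹ ≤ max 7 (|C| * (2 / c ^ 2)) * (ell D ^ 19)⁻¹ :=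
    mul_le_mul_of_nonneg_right (le_max_left _ _) h19pos.le
  -- the geometry of the four ranges
  have hord1 : P1pp D * etaPM D 1 < P2pp D * etaPM D (-1) := by
    rw [hPP]; nlinarith [mul_pos hP1pp hη1]
  simp only
  by_cases hn : 1 ≤ n
  swap
  · -- n = 0: everything vanishes
    have hn0 : n = 0 := by omega
    subst hn0
    have h1 : (0 : ℕ) ∉ ((Finset.Ico 1 ⌈P2pp D * etaPM D 1⌉₊).filter
          (fun n : ℕ => P1pp D * etaPM D (-1) < n ∧ (n : ℝ) < P2pp D * etaPM D 1)) := by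
      intro h; have := (Finset.mem_Ico.mp (Finset.mem_filter.mp h).1).1; omega
    have h2 : (0 : ℕ) ∉ ((Finset.Ico 1 ⌈P2pp D⌉₊).filter (fun n : ℕ => P1pp D < n ∧ (n : ℝ) < P2pp D)) := by
      intro h; have := (Finset.mem_Ico.mp (Finset.mem_filter.mp h).1).1; omega
    have h3 : ¬ (P2pp D * etaPM D (-1) ≤ ((0 : ℕ) : ℝ) ∧ (((0 : ℕ) : ℝ) < P2pp D * etaPM D 1)) := by
      rintro ⟨h, -⟩; push_cast at h; nlinarith [mul_pos hP2pp hη2]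
    rw [if_neg h1, if_neg h2, if_neg h3]; simp; positivity
  have hn0 : (0 : ℝ) < n := by exact_mod_cast hn
  have hr : 0 < (n : ℝ) / P1pp D := div_pos hn0 hP1pp
  have hχ := DirichletCharacter.norm_le_one χ (n : ZMod D)
  have hW : ‖(((n : ℝ) / P1pp D : ℝ) : ℂ) ^ beta6 D‖ = 1 := norm_cpow_beta6 hr
  -- case analysis on the position of `n`
  rcases lt_or_ge (n : ℝ) (P2pp D * etaPM D (-1)) with htop | htop
  · -- below the top window: `s n = 0`
    have hs : ¬ (P2pp D * etaPM D (-1) ≤ n ∧ (n : ℝ) < P2pp D * etaPM D 1) := fun h => by linarith [h.1]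
    rw [if_neg hs, sub_zero]
    rcases le_or_gt (n : ℝ) (P1pp D * etaPM D (-1)) with hout | hin
    · -- below everything: `c n = 0`
      have h1 : n ∉ ((Finset.Ico 1 ⌈P2pp D * etaPM D 1⌉₊).filter
          (fun n : ℕ => P1pp D * etaPM D (-1) < n ∧ (n : ℝ) < P2pp D * etaPM D 1)) := by
        intro h; linarith [(Finset.mem_filter.mp h).2.1]
      have h2 : n ∉ ((Finset.Ico 1 ⌈P2pp D⌉₊).filter (fun n : ℕ => P1pp D < n ∧ (n : ℝ) < P2pp D)) := by
        intro h; have := (Finset.mem_filter.mp h).2.1; nlinarith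
      rw [if_neg h1, if_neg h2, sub_zero, norm_zero]; positivity
    · have hm : n ∈ ((Finset.Ico 1 ⌈P2pp D * etaPM D 1⌉₊).filter
          (fun n : ℕ => P1pp D * etaPM D (-1) < n ∧ (n : ℝ) < P2pp D * etaPM D 1)) := mem_mainRange hn hin (by nlinarith [mul_lt_mul_of_pos_left hη3 hP2pp, mul_lt_mul_of_pos_left hη4 hP2pp])
      rw [if_pos hm]
      rcases le_or_gt (n : ℝ) (P1pp D * etaPM D 1) with hlow | hbk
      · -- the `P″₁` edge window
        have hI := abs_dualInt_le_low hℓ2 hn hlow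
        have hc0 : ‖χ (n : ZMod D) * (((n : ℝ) / P1pp D : ℝ) : ℂ) ^ beta6 D * ((dualInt D n / 0.504 : ℝ) : ℂ)‖
            ≤ (0.004 * (ell D ^ 19)⁻¹ + 2 * (ell D ^ 19)⁻¹) / 0.504 := by
          rw [norm_mul, norm_mul, hW, mul_one, Complex.norm_real, Real.norm_eq_abs, abs_div,
            abs_of_pos (by norm_num : (0 : ℝ) < 0.504)]
          calc ‖χ (n : ZMod D)‖ * (|dualInt D n| / 0.504) ≤ 1 * ((0.004 * Real.exp (-(ell D ^ 10)) +
              2 * (ell D ^ 19)⁻¹) / 0.504) := by gcongr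
            _ ≤ (0.004 * (ell D ^ 19)⁻¹ + 2 * (ell D ^ 19)⁻¹) / 0.504 := by
                rw [one_mul]; gcongr
        have hc1 : ‖(if n ∈ ((Finset.Ico 1 ⌈P2pp D⌉₊).filter (fun n : ℕ => P1pp D < n ∧ (n : ℝ) < P2pp D)) then
            χ (n : ZMod D) * (((n : ℝ) / P1pp D : ℝ) : ℂ) ^ beta6 D *
              ((Real.log ((n : ℝ) / P1pp D) / Real.log (Skeleton.P1 D) : ℝ) : ℂ) else 0)‖ ≤
            (ell D ^ 19)⁻¹ / 0.504 := by
          split_ifs with h16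
          · have hgt : P1pp D < n := ((mem_S16_iff hn).mp h16).1
            have hlog0 : 0 ≤ Real.log ((n : ℝ) / P1pp D) :=
              Real.log_nonneg (by rw [le_div_iff₀ hP1pp]; linarith)
            have hlog1 : Real.log ((n : ℝ) / P1pp D) ≤ (ell D ^ 10)⁻¹ := by
              have h1 : (n : ℝ) / P1pp D ≤ etaPM D 1 := by rw [div_le_iff₀ hP1pp]; linarith
              have := Real.log_le_log hr h1
              rwa [etaPM, one_mul, Real.log_exp] at this
            rw [norm_mul, norm_mul, hW, mul_one, Complex.norm_real, Real.norm_eq_abs, hlogP1, abs_div,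
              abs_of_nonneg hlog0, abs_of_pos (by positivity : (0 : ℝ) < 0.504 * ell D ^ 9)]
            calc ‖χ (n : ZMod D)‖ * (Real.log ((n : ℝ) / P1pp D) / (0.504 * ell D ^ 9))
                ≤ 1 * ((ell D ^ 10)⁻¹ / (0.504 * ell D ^ 9)) := by gcongr
              _ = (ell D ^ 19)⁻¹ / 0.504 := by field_simp
          · rw [norm_zero]; positivity
        calc _ ≤ ‖χ (n : ZMod D) * (((n : ℝ) / P1pp D : ℝ) : ℂ) ^ beta6 D * ((dualInt D n / 0.504 : ℝ) : ℂ)‖ +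
              ‖(if n ∈ ((Finset.Ico 1 ⌈P2pp D⌉₊).filter (fun n : ℕ => P1pp D < n ∧ (n : ℝ) < P2pp D)) then
                χ (n : ZMod D) * (((n : ℝ) / P1pp D : ℝ) : ℂ) ^ beta6 D *
                  ((Real.log ((n : ℝ) / P1pp D) / Real.log (Skeleton.P1 D) : ℝ) : ℂ) else 0)‖ :=
              norm_sub_le _ _
          _ ≤ (0.004 * (ell D ^ 19)⁻¹ + 2 * (ell D ^ 19)⁻¹) / 0.504 + (ell D ^ 19)⁻¹ / 0.504 :=
              add_le_add hc0 hc1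
          _ ≤ 7 * (ell D ^ 19)⁻¹ := by
              rw [← add_div, div_le_iff₀ (by norm_num : (0 : ℝ) < 0.504)]; nlinarith
          _ ≤ _ := hmax7
      · -- the bulk: exponentially small
        have hb := hbulk D χ hD₀ hq hp n hbk htop
        simp only [hm, if_true] at hb
        refine le_trans hb ?_
        have h1 : Real.exp (-c * ell D ^ 10) ≤ 2 / c ^ 2 * (ell D ^ 19)⁻¹ := by
          have h2 := exp_neg_le_two_div_sq (show 0 < c * ell D ^ 10 by positivity)
          have e1 : (c * ell D ^ 10) ^ 2 = c ^ 2 * ell D ^ 20 := by ring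
          have hc0 : c ≠ 0 := hc.ne'
          have hℓ0 : ell D ≠ 0 := hℓ.ne'
          calc Real.exp (-c * ell D ^ 10) = Real.exp (-(c * ell D ^ 10)) := by ring_nf
            _ ≤ 2 / (c * ell D ^ 10) ^ 2 := h2
            _ = 2 / c ^ 2 * (ell D ^ 20)⁻¹ := by rw [e1]; field_simp
            _ ≤ 2 / c ^ 2 * (ell D ^ 19)⁻¹ := by
                refine mul_le_mul_of_nonneg_left ?_ (by positivity)
                exact inv_anti₀ (pow_pos hℓ 19) (pow_le_pow_right₀ hℓ1 (by norm_num))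
        calc C * Real.exp (-c * ell D ^ 10) ≤ |C| * Real.exp (-c * ell D ^ 10) :=
              mul_le_mul_of_nonneg_right (le_abs_self C) (Real.exp_pos _).le
          _ ≤ |C| * (2 / c ^ 2 * (ell D ^ 19)⁻¹) := mul_le_mul_of_nonneg_left h1 (abs_nonneg C)
          _ = (|C| * (2 / c ^ 2)) * (ell D ^ 19)⁻¹ := by ring
          _ ≤ max 7 (|C| * (2 / c ^ 2)) * (ell D ^ 19)⁻¹ :=
              mul_le_mul_of_nonneg_right (le_max_right _ _) h19pos.le
  · rcases lt_or_ge (n : ℝ) (P2pp D * etaPM D 1) with hin | hout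
    · -- the `P″₂` edge window
      have hs : P2pp D * etaPM D (-1) ≤ n ∧ (n : ℝ) < P2pp D * etaPM D 1 := ⟨htop, hin⟩
      have hm : n ∈ ((Finset.Ico 1 ⌈P2pp D * etaPM D 1⌉₊).filter
          (fun n : ℕ => P1pp D * etaPM D (-1) < n ∧ (n : ℝ) < P2pp D * etaPM D 1)) := mem_mainRange hn
          (lt_of_lt_of_le (lt_trans (mul_lt_mul_of_pos_left (hη3.trans hη4) hP1pp) hord1) htop) hin
      rw [if_pos hs, if_pos hm]
      have hI := abs_dualInt_sub_le_top hℓ2 htop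
      have hP1n : P1pp D < n :=
        lt_of_lt_of_le (lt_trans (lt_mul_of_one_lt_right hP1pp hη4) hord1) htop
      -- the `H̄₁₆` coefficient on `[P″₂η₋, P″₂)` is `0.004/0.504 + log(n/P″₂)/(0.504𝓛⁹)`
      have hL : ∀ (h16 : (n : ℝ) < P2pp D),
          |Real.log ((n : ℝ) / P1pp D) / Real.log (Skeleton.P1 D) - 0.004 / 0.504| ≤ (ell D ^ 19)⁻¹ / 0.504 := by
        intro h16
        have hlogn : Real.log ((n : ℝ) / P1pp D) = 0.004 * ell D ^ 9 + Real.log ((n : ℝ) / P2pp D) := by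
          rw [Real.log_div hn0.ne' hP1pp.ne', Real.log_div hn0.ne' hP2pp.ne', hPP,
            Real.log_mul (Real.rpow_pos_of_pos (bigP_pos D) _).ne' hP1pp.ne', Real.log_rpow (bigP_pos D),
            log_bigP]
          ring
        have hlo : -(ell D ^ 10)⁻¹ ≤ Real.log ((n : ℝ) / P2pp D) := by
          have h1 : etaPM D (-1) ≤ (n : ℝ) / P2pp D := by rw [le_div_iff₀ hP2pp]; linarith
          have := Real.log_le_log hη2 h1
          rwa [etaPM, neg_one_mul, Real.log_exp] at this
        have hhi : Real.log ((n : ℝ) / P2pp D) ≤ 0 :=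
          Real.log_nonpos (div_pos hn0 hP2pp).le (by rw [div_le_one hP2pp]; exact h16.le)
        rw [hlogn, hlogP1, show (0.004 * ell D ^ 9 + Real.log ((n : ℝ) / P2pp D)) / (0.504 * ell D ^ 9) -
          0.004 / 0.504 = Real.log ((n : ℝ) / P2pp D) / (0.504 * ell D ^ 9) by field_simp; ring, abs_div,
          abs_of_pos (by positivity : (0 : ℝ) < 0.504 * ell D ^ 9), abs_of_nonpos hhi,
          div_le_div_iff₀ (by positivity) (by norm_num)]
        have : -Real.log ((n : ℝ) / P2pp D) * 0.504 ≤ (ell D ^ 10)⁻¹ * 0.504 :=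
          mul_le_mul_of_nonneg_right (by linarith [hlo]) (by norm_num)
        calc -Real.log ((n : ℝ) / P2pp D) * 0.504 ≤ (ell D ^ 10)⁻¹ * 0.504 := this
          _ = (ell D ^ 19)⁻¹ * (0.504 * ell D ^ 9) := by field_simp
      -- rewrite the difference as `χ·W·(real bracket)`
      have heq : (χ (n : ZMod D) * (((n : ℝ) / P1pp D : ℝ) : ℂ) ^ beta6 D * ((dualInt D n / 0.504 : ℝ) : ℂ) -
            (if n ∈ ((Finset.Ico 1 ⌈P2pp D⌉₊).filter (fun n : ℕ => P1pp D < n ∧ (n : ℝ) < P2pp D)) then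
              χ (n : ZMod D) * (((n : ℝ) / P1pp D : ℝ) : ℂ) ^ beta6 D *
                ((Real.log ((n : ℝ) / P1pp D) / Real.log (Skeleton.P1 D) : ℝ) : ℂ) else 0)) -
          ((0.004 / 0.504 : ℝ) : ℂ) * χ (n : ZMod D) * (((n : ℝ) / P1pp D : ℝ) : ℂ) ^ beta6 D *
            ((gW D (P2pp D / n) - (if (n : ℝ) < P2pp D then 1 else 0) : ℝ) : ℂ) =
          χ (n : ZMod D) * (((n : ℝ) / P1pp D : ℝ) : ℂ) ^ beta6 D *
            (((dualInt D n - 0.004 * gW D (P2pp D / n)) / 0.504 -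
              (if (n : ℝ) < P2pp D then Real.log ((n : ℝ) / P1pp D) / Real.log (Skeleton.P1 D) - 0.004 / 0.504
                else 0) : ℝ) : ℂ) := by
        by_cases h16 : (n : ℝ) < P2pp D
        · have hmem : n ∈ ((Finset.Ico 1 ⌈P2pp D⌉₊).filter (fun n : ℕ => P1pp D < n ∧ (n : ℝ) < P2pp D)) := (mem_S16_iff hn).mpr ⟨hP1n, h16⟩
          rw [if_pos hmem, if_pos h16, if_pos h16]; push_cast; ring
        · have hmem : n ∉ ((Finset.Ico 1 ⌈P2pp D⌉₊).filter (fun n : ℕ => P1pp D < n ∧ (n : ℝ) < P2pp D)) := fun h => h16 ((mem_S16_iff hn).mp h).2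
          rw [if_neg hmem, if_neg h16, if_neg h16]; push_cast; ring
      rw [heq, norm_mul, norm_mul, hW, mul_one, Complex.norm_real, Real.norm_eq_abs]
      have hbr : |(dualInt D n - 0.004 * gW D (P2pp D / n)) / 0.504 -
          (if (n : ℝ) < P2pp D then Real.log ((n : ℝ) / P1pp D) / Real.log (Skeleton.P1 D) - 0.004 / 0.504
            else 0)| ≤ (0.002 * (ell D ^ 19)⁻¹ + 2 * (ell D ^ 19)⁻¹) / 0.504 + (ell D ^ 19)⁻¹ / 0.504 := by
        refine le_trans (abs_sub _ _) (add_le_add ?_ ?_)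
        · rw [abs_div, abs_of_pos (by norm_num : (0 : ℝ) < 0.504)]
          refine div_le_div_of_nonneg_right (le_trans hI ?_) (by norm_num)
          gcongr
        · split_ifs with h16
          · exact hL h16
          · rw [abs_zero]; positivity
      calc ‖χ (n : ZMod D)‖ * |(dualInt D n - 0.004 * gW D (P2pp D / n)) / 0.504 -
            (if (n : ℝ) < P2pp D then Real.log ((n : ℝ) / P1pp D) / Real.log (Skeleton.P1 D) - 0.004 / 0.504
              else 0)|
          ≤ 1 * ((0.002 * (ell D ^ 19)⁻¹ + 2 * (ell D ^ 19)⁻¹) / 0.504 + (ell D ^ 19)⁻¹ / 0.504) := by gcongr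
        _ ≤ 7 * (ell D ^ 19)⁻¹ := by
            rw [one_mul, ← add_div, div_le_iff₀ (by norm_num : (0 : ℝ) < 0.504)]; nlinarith
        _ ≤ _ := hmax7
    · -- above everything: both vanish
      have hs : ¬ (P2pp D * etaPM D (-1) ≤ n ∧ (n : ℝ) < P2pp D * etaPM D 1) := fun h => by linarith [h.2]
      have h1 : n ∉ ((Finset.Ico 1 ⌈P2pp D * etaPM D 1⌉₊).filter
          (fun n : ℕ => P1pp D * etaPM D (-1) < n ∧ (n : ℝ) < P2pp D * etaPM D 1)) := by
        intro h; linarith [(Finset.mem_filter.mp h).2.2]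
      have h2 : n ∉ ((Finset.Ico 1 ⌈P2pp D⌉₊).filter (fun n : ℕ => P1pp D < n ∧ (n : ℝ) < P2pp D)) := by
        intro h; have := (Finset.mem_filter.mp h).2.2; nlinarith
      rw [if_neg hs, if_neg h1, if_neg h2, sub_zero, sub_zero, norm_zero]; positivity

/-- **The sharp part is a Gaussian transition of width `𝓛⁻¹⁵`**: for `n ≥ 1`,
`|s(n)| ≤ (0.002/0.504)·exp(−𝓛³⁰·log²(P″₂/n))` — (4.2) for `n < P″₂` (`1 − g(x) ≤ ½e^{−Λlog²x}`, `x ≥ 1`)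
and (4.3) for `n ≥ P″₂` (`g(x) ≤ ½e^{−Λlog²x}`, `x ≤ 1`), `Λ = 𝓛³⁰`, `𝓛 ≥ 1`.
[cite: Zhang2022LandauSiegel, §4 (4.2)–(4.3); §12 p.67] -/
theorem norm_sharp_le (hD : 1 ≤ Real.log D) {n : ℕ} (hn : 1 ≤ n) :
    ‖(if P2pp D * etaPM D (-1) ≤ n ∧ (n : ℝ) < P2pp D * etaPM D 1 then
          ((0.004 / 0.504 : ℝ) : ℂ) * χ (n : ZMod D) * (((n : ℝ) / P1pp D : ℝ) : ℂ) ^ beta6 D *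
            ((gW D (P2pp D / n) - (if (n : ℝ) < P2pp D then 1 else 0) : ℝ) : ℂ)
        else 0)‖ ≤ 0.002 / 0.504 * Real.exp (-(ell D ^ 30) * (Real.log (P2pp D / n)) ^ 2) := by
  have hℓ : 0 < ell D := by rw [ell]; linarith
  have hΛ : 0 < ell D ^ 30 := pow_pos hℓ 30
  have hP1pp := Sec12D.P1pp_pos hD
  have hP2pp := Sec12D.P2pp_pos hD
  have hn0 : (0 : ℝ) < n := by exact_mod_cast hn
  have hr : 0 < (n : ℝ) / P1pp D := div_pos hn0 hP1pp
  have hx : 0 < P2pp D / n := div_pos hP2pp hn0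
  split_ifs with hs h16
  · -- `n < P″₂`: `x = P″₂/n > 1`, `|g(x) − 1| = 1 − g(x)`
    have hx1 : 1 ≤ P2pp D / n := by rw [le_div_iff₀ hn0]; linarith
    obtain ⟨h0, h1⟩ := GaussWeight.one_sub_gWeight_le hΛ hx1
    rw [norm_mul, norm_mul, norm_mul, norm_cpow_beta6 hr, mul_one, Complex.norm_real, Complex.norm_real,
      Real.norm_eq_abs, Real.norm_eq_abs, abs_of_pos (by norm_num : (0 : ℝ) < 0.004 / 0.504),
      show gW D (P2pp D / n) - 1 = -(1 - GaussWeight.gWeight (ell D ^ 30) (P2pp D / n)) by rw [gW]; ring,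
      abs_neg, abs_of_nonneg h0]
    calc 0.004 / 0.504 * ‖χ (n : ZMod D)‖ * (1 - GaussWeight.gWeight (ell D ^ 30) (P2pp D / n))
        ≤ 0.004 / 0.504 * 1 * (1 / 2 * Real.exp (-(ell D ^ 30) * (Real.log (P2pp D / n)) ^ 2)) := by
          gcongr; exact DirichletCharacter.norm_le_one χ _
      _ = 0.002 / 0.504 * Real.exp (-(ell D ^ 30) * (Real.log (P2pp D / n)) ^ 2) := by ring
  · -- `n ≥ P″₂`: `x = P″₂/n ≤ 1`
    have hx1 : P2pp D / n ≤ 1 := by rw [div_le_one hn0]; linarith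
    have h1 := GaussWeight.gWeight_le hΛ hx hx1
    have g0 : 0 < GaussWeight.gWeight (ell D ^ 30) (P2pp D / n) := GaussWeight.gWeight_pos hΛ _
    rw [norm_mul, norm_mul, norm_mul, norm_cpow_beta6 hr, mul_one, Complex.norm_real, Complex.norm_real,
      Real.norm_eq_abs, Real.norm_eq_abs, abs_of_pos (by norm_num : (0 : ℝ) < 0.004 / 0.504), sub_zero, gW,
      abs_of_pos g0]
    calc 0.004 / 0.504 * ‖χ (n : ZMod D)‖ * GaussWeight.gWeight (ell D ^ 30) (P2pp D / n)
        ≤ 0.004 / 0.504 * 1 * (1 / 2 * Real.exp (-(ell D ^ 30) * (Real.log (P2pp D / n)) ^ 2)) := by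
          gcongr; exact DirichletCharacter.norm_le_one χ _
      _ = 0.002 / 0.504 * Real.exp (-(ell D ^ 30) * (Real.log (P2pp D / n)) ^ 2) := by ring
  · rw [norm_zero]; positivity

end Coefficients

end Literature.NumberTheory.LFunctions.Zhang2022.Typed.Sec12A
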